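import Literature.Topology.PlaneTopology.ChartCrossingJump
import Literature.Topology.PlaneTopology.SmoothUmlaufsatz
import HarnessLib

/-!
# Cutting a head out of a periodic loop

Topic: Topology / PlaneTopology, sequel to `WindingNumber.lean` and `ChartCrossingJump.lean`
(`wind_comp_reparam`: reparametrisation invariance of the winding number). Two more invariances
used to bring a loop into the shape `concatPath head rest` of the crossing formula
`wind_sub_wind_concatPath_chart`:

* rotating the parameter of a periodic loop does not change the winding number
  (`wind_comp_add_of_periodic` of `SmoothUmlaufsatz.lean`);
* `wind_eq_wind_concatPath_subarc` (**proved**): **any sub-arc `W|[t₁, t₂]` (`t₁ < t₂ ≤ t₁ + 1`)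
  can be made the head**: `wind W = wind (concatPath (W|[t₁, t₂]) (W|[t₂, t₁ + 1]))`, both pieces
  affinely reparametrised on `[0, 1]`.

All statements are [folklore].
-/

noncomputable section

open Set Filter Function Complex
open _root_.Topology
open scoped Real

namespace Literature.Topology.PlaneTopology

/-- **Any sub-arc of a periodic loop can be made the head of a concatenation without changing the
winding number.** [folklore] -/
theorem wind_eq_wind_concatPath_subarc {W : ℝ → ℂ} (hW : Continuous W) (hp : Periodic W 1) (hne : ∀ t, W t ≠ 0)
    {t₁ t₂ : ℝ} (h12 : t₁ < t₂) (h21 : t₂ ≤ t₁ + 1) :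
    wind W = wind (concatPath (fun s ↦ W (t₁ + s * (t₂ - t₁))) (fun s ↦ W (t₂ + s * (t₁ + 1 - t₂)))) := by
  rw [← wind_comp_add_of_periodic hW hne hp t₁]
  -- the rotated loop and the reparametrisation
  have hrot : IsNonvanishingLoop fun t ↦ W (t + t₁) :=
    ⟨(hW.comp (continuous_id.add continuous_const)).continuousOn, fun t _ ↦ hne _, by
      have := hp (0 + t₁); rw [show 0 + t₁ + 1 = 1 + t₁ by ring] at this; exact this.symm⟩
  set d : ℝ := t₂ - t₁ with hd
  have hd0 : 0 < d := by rw [hd]; linarith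
  have hd1 : d ≤ 1 := by rw [hd]; linarith
  set φ : ℝ → ℝ := fun t ↦ if t ≤ 1 / 2 then 2 * t * d else d + (2 * t - 1) * (1 - d) with hφ
  have hφc : Continuous φ :=
    Continuous.if_le (by fun_prop) (by fun_prop) continuous_id continuous_const fun t ht ↦ by rw [ht]; ring
  have hmaps : MapsTo φ (Icc 0 1) (Icc 0 1) := fun t ht ↦ by
    simp only [hφ]
    split_ifs with h
    · exact ⟨by nlinarith [ht.1], by nlinarith⟩
    · rw [not_le] at h
      exact ⟨by nlinarith, by nlinarith [ht.2]⟩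
  have hφ0 : φ 0 = 0 := by simp [hφ]
  have hφ1 : φ 1 = 1 := by simp only [hφ]; rw [if_neg (by norm_num)]; ring
  have heq : ∀ t ∈ Icc (0 : ℝ) 1, concatPath (fun s ↦ W (t₁ + s * (t₂ - t₁))) (fun s ↦ W (t₂ + s * (t₁ + 1 - t₂))) t =
      ((fun t ↦ W (t + t₁)) ∘ φ) t := by
    intro t _
    by_cases h : t ≤ 1 / 2
    · rw [concatPath_of_le_half h]
      show W (t₁ + 2 * t * (t₂ - t₁)) = W (φ t + t₁)
      simp only [hφ]; rw [if_pos h, hd]; ring_nf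
    · rw [concatPath_of_half_lt (not_le.1 h)]
      show W (t₂ + (2 * t - 1) * (t₁ + 1 - t₂)) = W (φ t + t₁)
      simp only [hφ]; rw [if_neg h, hd]; ring_nf
  rw [wind_congr heq, wind_comp_reparam hrot hφc.continuousOn hmaps hφ0 hφ1]

end Literature.Topology.PlaneTopology
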